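import Summits.QuantumFields.YangMills.Theorems.BalabanUVNodesN22W1RelCentredTermDatum214KeyedCo

/-!
# BalabanUVNodes ∕ node N22 = NE9 — THE W1 OBJECT ON THE RELATIVE-DISC CENTRED ROAD (RE-TYPING M1′), MODULE R5ᶜ (Co-KEYED TWIN of R5; KEY-RULE-21, binder `Provisos₁₃Core`): THE EDGE N18 → N22 AT THE READING OF RECORD, ALL RUN LENGTHS —
# `S_N22 (RRec₁₃Co[On] (readingOfRecord₁₃Co w1 …))` FROM `S_N18` THERE + the relative-disc centred per-term data AT EVERY LEVEL (the XL⁗ spine composite's N22 input, re-typed)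

Cell `pub-ymgap`, HUMAN RULING D-0062 (Track A), R134 ACCELERATION re-seat `pub-ymgap-dag-n22-c` (strategy s1), generation 6, file R5ᶜ of the re-typed line.  THEOREMS ONLY; imports R2cᶜ
`…N22W1RelCentredTermDatum214KeyedCo` (the Co twin of R2c) and uses dag-n22-e's Co rate-reading faces `s_N22_readingOfRecord₁₃Co[On]_iff`, `s_N18_readingOfRecord₁₃Co[On]_iff`,
`readingOfRecord₁₃Co_bundle_u3` (dag-n22-e Co edition `…RateReadingOfRecord13Co`) and RR-2's key faces `IsDatumOfRecord₁₃CCo.params ∕ .provisos ∕ .admissible` BY NAME.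
`--supports` K3⁗ `SpineGivenEndpointR13Sep` (stmt-QuantumFields-20292) as a helper.

WHY.  The K3⁗ skeleton reads N22 at the LEVEL-SELECTED tuple reading (`ksel`; R2b §2 ∕ R2c serve that binder verbatim), but the spine COMPOSITES at the reading of record —
dag-n27-c's XL⁗ `spine_rec13CSep_at_readingAdm₁₃Sep` (canonical home) and `spine_rec13CSepOn_at_readingAdm₁₃Sep` (regime home) — consume N22 as the rate-record stub
`S_N22 (RRec₁₃Co[On] (readingOfRecord₁₃Co w1 ℓ₃ ne2 ne1))`, i.e. `N22At` at EVERY run length `k`, and today they display it through dag-n22-e's 8a″ edge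
`s_N22_readingOfRecord₁₃Co[On]_ofRecordAdm_of_s_N18_analytic`, whose clause `hA` asks a holomorphic `Fz` on UNIFORM discs `closedBall (t:ℂ) li.r`, `t ∈ ]0,γ]` — the located
(S-last) currency (analyticity at zero coupling; F3 `…StripLastTermwiseVertexRider` + lens T12: possibility-2-typed).  THIS FILE supplies the same two stubs from `S_N18` at the
same home + the RE-TYPED data of R2c AT EVERY LEVEL `k` (relative discs `closedBall (t:ℂ) (cA·t)`, continued family `TFc` + real-window agreement, (S-226-T′) ∕ (S-vertex-T′) at
complex coupling, coupling-blind centre `V`), so an XL edition can display N22's input in the relative-disc centred currency by citing one name.  Mechanism: R2c's guarded binder at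
the constant selector `ksel := fun _ _ _ _ ↦ k` and the bundle face `readingOfRecord₁₃Co_bundle_u3` (regime home); the canonical home through the regime
`Rg F θ := ∃ D (h : IsDatumOfRecord₁₃CCo F N D), h.params = θ` (N18 at keyed data is all `S_N18 (RRec₁₃Co …)` gives, and all the engine needs).

WHAT.  §1 ★ `s_N22_readingOfRecord₁₃CoOn_ofRecordAdm_runTowers_of_s_N18_relCentredTermDatum₀` (regime home, any `Rg`) · §2 ★ `s_N22_readingOfRecord₁₃Co_ofRecordAdm_runTowers_of_
s_N18_relCentredTermDatum₀` (canonical home).  Reading: `w1 := fun F θ ↦ ReadingData.ofRecordAdm F θ.τ9.M N (runTowers fun k ↦ toClusterTower ((𝔇 F θ k).Gn₀)) (sp F θ) (gauge F θ)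
(hg F θ) (T₀ F θ) (hT F θ) (li F θ)` — XL⁗'s `S F θ := runTowers fun k ↦ toClusterTower ((𝔇 F θ k).Gn₀)` (the admissible run towers GENERATED by the (2.14) term data of record).

HONEST FRAMING.  Bookkeeping (two compositions BY NAME); count-neutral; the per-term schemas at complex coupling are HYPOTHESES, now AT EVERY LEVEL ((S-vertex-T′) is NOT PRINTED —
the first missing estimate of row n22 s1); `S_N18` is N18's; no inhabitant of `IsDatumOfRecord₁₃CCo` ∕ admissible tuple claimed (K0⁗ OPEN); nothing of Bałaban's asserted; N22
NOT discharged; one finite four-torus programme at fixed ε — NOT infinite volume, NOT OS on ℝ⁴, NOT a mass gap, NOT Clay.  0 `sorry`, 0 `def`, standard axioms.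

References (TYPES only): [I] = [Balaban1987RG1] (0.23)–(0.25) pp. 256–257, §1 p. 263, (2.9)–(2.10) pp. 266–267, (2.13) p. 268; [II] = [Balaban1988RG2Cluster] (1.41) p. 11,
(2.9)–(2.15) pp. 14–16, (2.26) p. 17, Lemma 3 p. 20, (2.39)–(2.41) p. 21.
-/

noncomputable section

open scoped Matrix.Norms.L2Operator

namespace YMDAG.N22.W1

open Set Metric
open scoped BigOperators
open Literature.MathematicalPhysics.QuantumFieldTheory.Balaban1983to89
open Literature.MathematicalPhysics.QuantumFieldTheory.Balaban1983to89.T4Continuum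
open Literature.MathematicalPhysics.QuantumFieldTheory.Balaban1983to89.T4OutputRate
open Literature.MathematicalPhysics.QuantumFieldTheory.Balaban1983to89.TreeLengthTorus (TPt TDom tsys torusTreeLen torusTreeLen_nonneg)
open Literature.MathematicalPhysics.QuantumFieldTheory.Balaban1983to89.B12TreeDecay (K₀ K₀_pos)
open Literature.MathematicalPhysics.QuantumFieldTheory.Balaban1983to89.B13Lemma3TorusData (TBond)
open Literature.MathematicalPhysics.QuantumFieldTheory.Balaban1983to89.B13Lemma3TorusTerms (terms weight weight_nonneg)
open Literature.MathematicalPhysics.QuantumFieldTheory.Balaban1983to89.B13Lemma3TorusSocket (Lemma3Numerics)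
open Literature.MathematicalPhysics.QuantumFieldTheory.Balaban1983to89.Step (SFConsts)
open Literature.MathematicalPhysics.QuantumFieldTheory.Balaban1983to89.Node00
  (Stage12Params Stage13Params U3Objects₁₁ U3Letters₁₁ NE2Objects₁₁ NE3Letters₁₁ MatA ιSU prependCoupling)
open Literature.MathematicalPhysics.QuantumFieldTheory.Balaban1983to89.Node00.Sect2 (domSys domCount CPair ofBackgroundC spaceI domSites Setting Residual)
open Literature.MathematicalPhysics.QuantumFieldTheory.Balaban1983to89.Node00.W1
open YMDAG.UVSplit

variable {N : ℕ} [NeZero N]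

section Edge


variable (c : (F : T4Family) → Stage13Params F N → ℕ → B13.Consts) (L : (F : T4Family) → Stage13Params F N → ℕ → ℕ) [hL : ∀ F θ k, NeZero (L F θ k)]
  (𝔇 : (F : T4Family) → (θ : Stage13Params F N) → (k : ℕ) → TermData214 (c F θ k) (F.P k) (MatA N) θ.τ9.M (L F θ k))
  (sp : (F : T4Family) → (θ : Stage13Params F N) → (k j : ℕ) → (domSys (F.P k) θ.τ9.M j).Dom → Set (CPair (F.P k) (MatA N)))
  (gauge : (F : T4Family) → (θ : Stage13Params F N) → (k : ℕ) → GaugeField (F.P k) 0 (Node00.SU N) → GaugeField (F.P k) 0 (Node00.SU N) → ℝ)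
  (hg : ∀ (F : T4Family) (θ : Stage13Params F N) (k : ℕ) (U U' : GaugeField (F.P k) 0 (Node00.SU N)), 0 ≤ gauge F θ k U U')
  (T₀ : (F : T4Family) → (θ : Stage13Params F N) → (k : ℕ) → GaugeField (F.P (k + 1)) 0 (Node00.SU N) → GaugeField (F.P k) 0 (Node00.SU N))
  (hT : ∀ (F : T4Family) (θ : Stage13Params F N) (k : ℕ) (U : GaugeField (F.P (k + 1)) 0 (Node00.SU N)),
    (∀ (j : ℕ) (Y : (domSys (F.P (k + 1)) θ.τ9.M j).Dom), ofBackgroundC (ιSU N) U ∈ sp F θ (k + 1) j Y) →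
      ∀ (j : ℕ) (X : (domSys (F.P k) θ.τ9.M j).Dom), ofBackgroundC (ιSU N) (T₀ F θ k U) ∈ sp F θ k j X)
  (li : (F : T4Family) → Stage13Params F N → LetterInputs) (ℓ₃ : T4Family → NE3Letters₁₁)
  (ne2 : (F : T4Family) → Stage13Params F N → (ℕ → ℝ) → List (ULoop F) → ℕ → NE2Objects₁₁)
  (ne1 : (F : T4Family) → Stage13Params F N → (ℕ → ℝ) → List (ULoop F) → NE1pCarriers)
  (Rg : (F : T4Family) → Stage13Params F N → Prop) {G : Type*} [GaugeGroup G]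


open Classical in
/-- **THE EDGE N18 → N22 AT THE REGIME-RESTRICTED READING OF RECORD, ALL RUN LENGTHS, RELATIVE-DISC CENTRED CURRENCY** (any regime `Rg`): `S_N22 (RRec₁₃CoOn (readingOfRecord₁₃Co w1
ℓ₃ ne2 ne1) Rg)` for the (2.14)-generated admissible reading `w1`, from `S_N18` at the same home, the letter signs (`li.μ = 1`, `li.s = ½`) and, per admissible tuple with provisos in
the regime and PER LEVEL `k`, the R2c data for the datum `𝔇 F θ k` (socket letters + numerals, domain family with relative discs, continued family `TFc` + real-window agreement,
(S-last-T′) ∕ (S-226-T′) ∕ (S-vertex-T′) at complex coupling, coupling-blind centre `V` with its (P)-schema).  Proof: R2c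
`n22_tupleReadingOfRecordCoOn_relCentredTermDatum₀_of_n18Below` at the constant selector `fun _ _ _ _ ↦ k`, N18 below from `s_N18_readingOfRecord₁₃CoOn_iff`, bundle face
`readingOfRecord₁₃Co_bundle_u3`, `s_N22_readingOfRecord₁₃CoOn_iff`. [cite: Balaban1988RG2Cluster, (1.41) p.11, (2.9)-(2.15) pp.14-16, (2.26) p.17, Lemma 3 p.20 and (2.39)-(2.41) p.21; Balaban1987RG1, (0.23)-(0.25) pp.256-257, §1 p.263, (2.9)-(2.10) pp.266-267 and (2.13) p.268] -/
theorem s_N22_readingOfRecord₁₃CoOn_ofRecordAdm_runTowers_of_s_N18_relCentredTermDatum₀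
    (h18 : S_N18 (RRec₁₃CoOn (readingOfRecord₁₃Co (fun F θ => ReadingData.ofRecordAdm F θ.τ9.M N (runTowers fun k => toClusterTower ((𝔇 F θ k).Gn₀)) (sp F θ)
        (gauge F θ) (hg F θ) (T₀ F θ) (hT F θ) (li F θ)) ℓ₃ ne2 ne1) Rg))
    (hnum : ∀ (F : T4Family) (θ : Stage13Params F N), θ.Provisos₁₃Core F N → Rg F θ → θ.Admissible F N →
      0 < (li F θ).C₀ ∧ 0 < (li F θ).θ₅ ∧ (li F θ).θ₅ < 1 ∧ 0 ≤ (li F θ).C₅ ∧ 2 * (li F θ).C₅ / (1 - (li F θ).θ₅) ≤ (li F θ).C₀ ∧ 0 < (li F θ).A ∧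
        (li F θ).μ = 1 ∧ 0 < (li F θ).r ∧ (li F θ).s = (2 : ℝ)⁻¹)
    (hdata : ∀ (F : T4Family) (θ : Stage13Params F N), θ.Provisos₁₃Core F N → Rg F θ → θ.Admissible F N → ∀ (k : ℕ),
      ∃ (_ : NeZero θ.τ9.M) (Sg : Setting (MatA N) G) (Rz : Residual (F.P k) (MatA N))
        (cs : SFConsts) (a a₂ a₂' a₅ a₅' Aabs r₁ E₀ Mv cA : ℝ) (TFc : GenTermFun (F.P k) (MatA N) θ.τ9.M (L F θ k))
        (V : (k' : ℕ) → (domSys (F.P k) θ.τ9.M (k' + 1)).Dom → TermLabel (F.P k) θ.τ9.M k' (L F θ k) →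
          OlderTerms (F.P k) (MatA N) θ.τ9.M k' → CPair (F.P k) (MatA N) → ℂ)
        (D : ℕ → Set ℂ),
        (∀ (j : ℕ) (Y : (domSys (F.P k) θ.τ9.M j).Dom),
          sp F θ k j Y ⊆ spaceI Sg Rz θ.τ9.M j (domSites (F.P k) θ.τ9.M j Y) cs.α₀ cs.α₁) ∧
        8 ≤ (c F θ k).L ∧ (c F θ k).L = L F θ k ∧
        Lemma3Numerics (c F θ k) θ.τ9.M (((c F θ k).L : ℝ) / 2) a a₂ a₂' a₅' Aabs ∧
        0 ≤ (c F θ k).C3act * (c F θ k).ε₁ ∧ 0 ≤ r₁ ∧ (li F θ).κ ≤ r₁ ∧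
        r₁ + 2 * (64 * Real.log 162) + 2 ≤ (1 - 8 * (c F θ k).δ) * (((c F θ k).L : ℝ) / 2) * (c F θ k).κ ∧
        (c F θ k).C3act * (c F θ k).ε₁ * Real.exp (5 * r₁ + 1) * K₀ 64 8 * 9 * 64 ≤ 1 ∧
        Real.exp 1 * 9 * 64 * K₀ 64 8 ^ 2 * ((c F θ k).C3act * (c F θ k).ε₁) ≤ E₀ ∧
        (∀ (k' : ℕ) (Z : (domSys (F.P k) θ.τ9.M (k' + 1)).Dom), 2 * Real.exp (a₅ * ((Z.1).card : ℝ)) ≤ Real.exp (a₅' * ((Z.1).card : ℝ))) ∧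
        (∀ i, IsOpen (D i)) ∧ (∀ (i : ℕ), ∀ t ∈ Ioc (0 : ℝ) θ.γ, ((t : ℝ) : ℂ) ∈ D i) ∧ (∀ (i : ℕ), ∀ t ∈ Ioc (0 : ℝ) θ.γ, closedBall (t : ℂ) (cA * t) ⊆ D i) ∧
        0 < cA ∧ cA < 1 ∧ 0 < Mv ∧ Mv * ((1 + cA) * θ.γ) ^ 2 ≤ 1 / 2 ∧ 2 * Mv * E₀ * (1 + cA) ^ 2 ≤ (li F θ).A ∧ (li F θ).r ≤ min cA 1 ∧
        (∀ (k' : ℕ) (Z : (domSys (F.P k) θ.τ9.M (k' + 1)).Dom) (t : TermLabel (F.P k) θ.τ9.M k' (L F θ k)) (s : ℝ),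
          s ∈ Ioc (0 : ℝ) θ.γ → ∀ (old : OlderTerms (F.P k) (MatA N) θ.τ9.M k') (φ : CPair (F.P k) (MatA N)),
            TFc k' Z t (s : ℂ) old φ = (𝔇 F θ k k').TF Z t (s : ℂ) old φ) ∧
        (∀ k' : ℕ, k' < k → ∀ old : OlderTerms (F.P k) (MatA N) θ.τ9.M k',
          (∀ (j : Fin (k' + 1)) (Y : (domSys (F.P k) θ.τ9.M j).Dom) (ψ : CPair (F.P k) (MatA N)),
              ψ ∈ spaceI Sg Rz θ.τ9.M j (domSites (F.P k) θ.τ9.M j Y) cs.α₀ cs.α₁ → ‖old j Y ψ‖ ≤ E₀ * Real.exp (-((li F θ).κ * torusTreeLen Y.1))) →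
          ∀ (X : (domSys (F.P k) θ.τ9.M (k' + 1)).Dom) (φ : CPair (F.P k) (MatA N)),
            φ ∈ spaceI Sg Rz θ.τ9.M (k' + 1) (domSites (F.P k) θ.τ9.M (k' + 1) X) cs.α₀ cs.α₁ →
            ∀ (Z : (domSys (F.P k) θ.τ9.M (k' + 1)).Dom), Z.1 ⊆ X.1 → ∀ t ∈ terms (L F θ k) θ.τ9.M Z,
              DifferentiableOn ℂ (fun z => TFc k' Z t z old φ) (D k') ∧
                ∀ z ∈ D k', ‖TFc k' Z t z old φ‖ ≤ weight (L F θ k) θ.τ9.M (c F θ k) Z a t * Real.exp (a₅ * ((Z.1).card : ℝ))) ∧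
        (∀ k' : ℕ, k' < k → ∀ i : ℕ, i < k' → ∀ (O : Set ℂ), IsOpen O → ∀ u ∈ D k', ∀ cv : ℂ → OlderTerms (F.P k) (MatA N) θ.τ9.M k',
          (∀ (j : Fin (k' + 1)) (Y : (domSys (F.P k) θ.τ9.M j).Dom) (ψ : CPair (F.P k) (MatA N)),
              ψ ∈ spaceI Sg Rz θ.τ9.M j (domSites (F.P k) θ.τ9.M j Y) cs.α₀ cs.α₁ →
              DifferentiableOn ℂ (fun z => cv z j Y ψ) O ∧ ∀ z ∈ O, ‖cv z j Y ψ‖ ≤ E₀ * Real.exp (-((li F θ).κ * torusTreeLen Y.1))) →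
          ∀ (X : (domSys (F.P k) θ.τ9.M (k' + 1)).Dom) (φ : CPair (F.P k) (MatA N)),
            φ ∈ spaceI Sg Rz θ.τ9.M (k' + 1) (domSites (F.P k) θ.τ9.M (k' + 1) X) cs.α₀ cs.α₁ →
            ∀ (Z : (domSys (F.P k) θ.τ9.M (k' + 1)).Dom), Z.1 ⊆ X.1 → ∀ t ∈ terms (L F θ k) θ.τ9.M Z,
              DifferentiableOn ℂ (fun z => TFc k' Z t u (cv z) φ) O ∧
                ∀ z ∈ O, ‖TFc k' Z t u (cv z) φ‖ ≤ weight (L F θ k) θ.τ9.M (c F θ k) Z a t * Real.exp (a₅ * ((Z.1).card : ℝ))) ∧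
        (∀ k' : ℕ, k' < k → ∀ (O : Set ℂ), IsOpen O → ∀ cv : ℂ → OlderTerms (F.P k) (MatA N) θ.τ9.M k',
          (∀ (j : Fin (k' + 1)) (Y : (domSys (F.P k) θ.τ9.M j).Dom) (ψ : CPair (F.P k) (MatA N)),
              ψ ∈ spaceI Sg Rz θ.τ9.M j (domSites (F.P k) θ.τ9.M j Y) cs.α₀ cs.α₁ →
              DifferentiableOn ℂ (fun z => cv z j Y ψ) O ∧ ∀ z ∈ O, ‖cv z j Y ψ‖ ≤ E₀ * Real.exp (-((li F θ).κ * torusTreeLen Y.1))) →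
          ∀ (X : (domSys (F.P k) θ.τ9.M (k' + 1)).Dom) (φ : CPair (F.P k) (MatA N)),
            φ ∈ spaceI Sg Rz θ.τ9.M (k' + 1) (domSites (F.P k) θ.τ9.M (k' + 1) X) cs.α₀ cs.α₁ →
            ∀ (Z : (domSys (F.P k) θ.τ9.M (k' + 1)).Dom), Z.1 ⊆ X.1 → ∀ t ∈ terms (L F θ k) θ.τ9.M Z,
              DifferentiableOn ℂ (fun z => V k' Z t (cv z) φ) O ∧
                ∀ z ∈ O, ‖V k' Z t (cv z) φ‖ ≤ weight (L F θ k) θ.τ9.M (c F θ k) Z a t * Real.exp (a₅ * ((Z.1).card : ℝ))) ∧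
        (∀ k' : ℕ, k' < k → ∀ old : OlderTerms (F.P k) (MatA N) θ.τ9.M k',
          (∀ (j : Fin (k' + 1)) (Y : (domSys (F.P k) θ.τ9.M j).Dom) (ψ : CPair (F.P k) (MatA N)),
              ψ ∈ spaceI Sg Rz θ.τ9.M j (domSites (F.P k) θ.τ9.M j Y) cs.α₀ cs.α₁ → ‖old j Y ψ‖ ≤ E₀ * Real.exp (-((li F θ).κ * torusTreeLen Y.1))) →
          ∀ (X : (domSys (F.P k) θ.τ9.M (k' + 1)).Dom) (φ : CPair (F.P k) (MatA N)),
            φ ∈ spaceI Sg Rz θ.τ9.M (k' + 1) (domSites (F.P k) θ.τ9.M (k' + 1) X) cs.α₀ cs.α₁ →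
            ∀ (Z : (domSys (F.P k) θ.τ9.M (k' + 1)).Dom), Z.1 ⊆ X.1 → ∀ t ∈ terms (L F θ k) θ.τ9.M Z, ∀ z ∈ D k',
              ‖TFc k' Z t z old φ - V k' Z t old φ‖ ≤
                Mv * ‖z‖ ^ 2 * (weight (L F θ k) θ.τ9.M (c F θ k) Z a t * Real.exp (a₅ * ((Z.1).card : ℝ))))) :
    S_N22 (RRec₁₃CoOn (readingOfRecord₁₃Co (fun F θ => ReadingData.ofRecordAdm F θ.τ9.M N (runTowers fun k => toClusterTower ((𝔇 F θ k).Gn₀)) (sp F θ)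
        (gauge F θ) (hg F θ) (T₀ F θ) (hT F θ) (li F θ)) ℓ₃ ne2 ne1) Rg) := by
  refine (s_N22_readingOfRecord₁₃CoOn_iff _ ℓ₃ ne2 ne1 Rg).mpr fun F θ hP hRg hθ k => ?_
  have h :=
    n22_tupleReadingOfRecordCoOn_relCentredTermDatum₀_of_n18Below c L 𝔇 sp gauge hg T₀ hT li ℓ₃ ne2 ne1 (fun _ _ _ _ => k) Rg (G := G)
      (fun F θ hP hRg hθ _ _ k' hk' => (s_N18_readingOfRecord₁₃CoOn_iff _ ℓ₃ ne2 ne1 Rg).mp h18 F θ hP hRg hθ k') hnum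
      (fun F θ hP hRg hθ _ _ => hdata F θ hP hRg hθ k) F θ hP hRg hθ (fun _ => 0) []
  rwa [readingOfRecord₁₃Co_bundle_u3] at h

open Classical in
/-- **THE EDGE N18 → N22 AT THE CANONICAL READING OF RECORD, ALL RUN LENGTHS, RELATIVE-DISC CENTRED CURRENCY**: `S_N22 (RRec₁₃Co (readingOfRecord₁₃Co w1 ℓ₃ ne2 ne1))` from
`S_N18` there + the signs + the R2c data PER admissible tuple with provisos AND LEVEL — the XL⁗ composite's N22 input (`spine_rec13CSep_at_readingAdm₁₃Sep`, at
`S F θ := runTowers fun k ↦ toClusterTower ((𝔇 F θ k).Gn₀)`) in the re-typed currency, replacing 8a″'s located clause `hA` (uniform discs `closedBall (t:ℂ) li.r`).  Proof: §1 at the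
regime `Rg F θ := ∃ D (h : IsDatumOfRecord₁₃CCo F N D), h.params = θ` (what `S_N18 (RRec₁₃Co …)` supplies: N18 at KEYED data), then RR-2's `h.params ∕ h.provisos ∕ h.admissible`.
[cite: Balaban1988RG2Cluster, (1.41) p.11, (2.9)-(2.15) pp.14-16, (2.26) p.17, Lemma 3 p.20 and (2.39)-(2.41) p.21; Balaban1987RG1, (0.23)-(0.25) pp.256-257, §1 p.263, (2.9)-(2.10) pp.266-267 and (2.13) p.268] -/
theorem s_N22_readingOfRecord₁₃Co_ofRecordAdm_runTowers_of_s_N18_relCentredTermDatum₀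
    (h18 : S_N18 (RRec₁₃Co (readingOfRecord₁₃Co (fun F θ => ReadingData.ofRecordAdm F θ.τ9.M N (runTowers fun k => toClusterTower ((𝔇 F θ k).Gn₀)) (sp F θ)
        (gauge F θ) (hg F θ) (T₀ F θ) (hT F θ) (li F θ)) ℓ₃ ne2 ne1)))
    (hnum : ∀ (F : T4Family) (θ : Stage13Params F N), θ.Provisos₁₃Core F N → θ.Admissible F N →
      0 < (li F θ).C₀ ∧ 0 < (li F θ).θ₅ ∧ (li F θ).θ₅ < 1 ∧ 0 ≤ (li F θ).C₅ ∧ 2 * (li F θ).C₅ / (1 - (li F θ).θ₅) ≤ (li F θ).C₀ ∧ 0 < (li F θ).A ∧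
        (li F θ).μ = 1 ∧ 0 < (li F θ).r ∧ (li F θ).s = (2 : ℝ)⁻¹)
    (hdata : ∀ (F : T4Family) (θ : Stage13Params F N), θ.Provisos₁₃Core F N → θ.Admissible F N → ∀ (k : ℕ),
      ∃ (_ : NeZero θ.τ9.M) (Sg : Setting (MatA N) G) (Rz : Residual (F.P k) (MatA N))
        (cs : SFConsts) (a a₂ a₂' a₅ a₅' Aabs r₁ E₀ Mv cA : ℝ) (TFc : GenTermFun (F.P k) (MatA N) θ.τ9.M (L F θ k))
        (V : (k' : ℕ) → (domSys (F.P k) θ.τ9.M (k' + 1)).Dom → TermLabel (F.P k) θ.τ9.M k' (L F θ k) →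
          OlderTerms (F.P k) (MatA N) θ.τ9.M k' → CPair (F.P k) (MatA N) → ℂ)
        (D : ℕ → Set ℂ),
        (∀ (j : ℕ) (Y : (domSys (F.P k) θ.τ9.M j).Dom),
          sp F θ k j Y ⊆ spaceI Sg Rz θ.τ9.M j (domSites (F.P k) θ.τ9.M j Y) cs.α₀ cs.α₁) ∧
        8 ≤ (c F θ k).L ∧ (c F θ k).L = L F θ k ∧
        Lemma3Numerics (c F θ k) θ.τ9.M (((c F θ k).L : ℝ) / 2) a a₂ a₂' a₅' Aabs ∧
        0 ≤ (c F θ k).C3act * (c F θ k).ε₁ ∧ 0 ≤ r₁ ∧ (li F θ).κ ≤ r₁ ∧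
        r₁ + 2 * (64 * Real.log 162) + 2 ≤ (1 - 8 * (c F θ k).δ) * (((c F θ k).L : ℝ) / 2) * (c F θ k).κ ∧
        (c F θ k).C3act * (c F θ k).ε₁ * Real.exp (5 * r₁ + 1) * K₀ 64 8 * 9 * 64 ≤ 1 ∧
        Real.exp 1 * 9 * 64 * K₀ 64 8 ^ 2 * ((c F θ k).C3act * (c F θ k).ε₁) ≤ E₀ ∧
        (∀ (k' : ℕ) (Z : (domSys (F.P k) θ.τ9.M (k' + 1)).Dom), 2 * Real.exp (a₅ * ((Z.1).card : ℝ)) ≤ Real.exp (a₅' * ((Z.1).card : ℝ))) ∧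
        (∀ i, IsOpen (D i)) ∧ (∀ (i : ℕ), ∀ t ∈ Ioc (0 : ℝ) θ.γ, ((t : ℝ) : ℂ) ∈ D i) ∧ (∀ (i : ℕ), ∀ t ∈ Ioc (0 : ℝ) θ.γ, closedBall (t : ℂ) (cA * t) ⊆ D i) ∧
        0 < cA ∧ cA < 1 ∧ 0 < Mv ∧ Mv * ((1 + cA) * θ.γ) ^ 2 ≤ 1 / 2 ∧ 2 * Mv * E₀ * (1 + cA) ^ 2 ≤ (li F θ).A ∧ (li F θ).r ≤ min cA 1 ∧
        (∀ (k' : ℕ) (Z : (domSys (F.P k) θ.τ9.M (k' + 1)).Dom) (t : TermLabel (F.P k) θ.τ9.M k' (L F θ k)) (s : ℝ),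
          s ∈ Ioc (0 : ℝ) θ.γ → ∀ (old : OlderTerms (F.P k) (MatA N) θ.τ9.M k') (φ : CPair (F.P k) (MatA N)),
            TFc k' Z t (s : ℂ) old φ = (𝔇 F θ k k').TF Z t (s : ℂ) old φ) ∧
        (∀ k' : ℕ, k' < k → ∀ old : OlderTerms (F.P k) (MatA N) θ.τ9.M k',
          (∀ (j : Fin (k' + 1)) (Y : (domSys (F.P k) θ.τ9.M j).Dom) (ψ : CPair (F.P k) (MatA N)),
              ψ ∈ spaceI Sg Rz θ.τ9.M j (domSites (F.P k) θ.τ9.M j Y) cs.α₀ cs.α₁ → ‖old j Y ψ‖ ≤ E₀ * Real.exp (-((li F θ).κ * torusTreeLen Y.1))) →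
          ∀ (X : (domSys (F.P k) θ.τ9.M (k' + 1)).Dom) (φ : CPair (F.P k) (MatA N)),
            φ ∈ spaceI Sg Rz θ.τ9.M (k' + 1) (domSites (F.P k) θ.τ9.M (k' + 1) X) cs.α₀ cs.α₁ →
            ∀ (Z : (domSys (F.P k) θ.τ9.M (k' + 1)).Dom), Z.1 ⊆ X.1 → ∀ t ∈ terms (L F θ k) θ.τ9.M Z,
              DifferentiableOn ℂ (fun z => TFc k' Z t z old φ) (D k') ∧
                ∀ z ∈ D k', ‖TFc k' Z t z old φ‖ ≤ weight (L F θ k) θ.τ9.M (c F θ k) Z a t * Real.exp (a₅ * ((Z.1).card : ℝ))) ∧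
        (∀ k' : ℕ, k' < k → ∀ i : ℕ, i < k' → ∀ (O : Set ℂ), IsOpen O → ∀ u ∈ D k', ∀ cv : ℂ → OlderTerms (F.P k) (MatA N) θ.τ9.M k',
          (∀ (j : Fin (k' + 1)) (Y : (domSys (F.P k) θ.τ9.M j).Dom) (ψ : CPair (F.P k) (MatA N)),
              ψ ∈ spaceI Sg Rz θ.τ9.M j (domSites (F.P k) θ.τ9.M j Y) cs.α₀ cs.α₁ →
              DifferentiableOn ℂ (fun z => cv z j Y ψ) O ∧ ∀ z ∈ O, ‖cv z j Y ψ‖ ≤ E₀ * Real.exp (-((li F θ).κ * torusTreeLen Y.1))) →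
          ∀ (X : (domSys (F.P k) θ.τ9.M (k' + 1)).Dom) (φ : CPair (F.P k) (MatA N)),
            φ ∈ spaceI Sg Rz θ.τ9.M (k' + 1) (domSites (F.P k) θ.τ9.M (k' + 1) X) cs.α₀ cs.α₁ →
            ∀ (Z : (domSys (F.P k) θ.τ9.M (k' + 1)).Dom), Z.1 ⊆ X.1 → ∀ t ∈ terms (L F θ k) θ.τ9.M Z,
              DifferentiableOn ℂ (fun z => TFc k' Z t u (cv z) φ) O ∧
                ∀ z ∈ O, ‖TFc k' Z t u (cv z) φ‖ ≤ weight (L F θ k) θ.τ9.M (c F θ k) Z a t * Real.exp (a₅ * ((Z.1).card : ℝ))) ∧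
        (∀ k' : ℕ, k' < k → ∀ (O : Set ℂ), IsOpen O → ∀ cv : ℂ → OlderTerms (F.P k) (MatA N) θ.τ9.M k',
          (∀ (j : Fin (k' + 1)) (Y : (domSys (F.P k) θ.τ9.M j).Dom) (ψ : CPair (F.P k) (MatA N)),
              ψ ∈ spaceI Sg Rz θ.τ9.M j (domSites (F.P k) θ.τ9.M j Y) cs.α₀ cs.α₁ →
              DifferentiableOn ℂ (fun z => cv z j Y ψ) O ∧ ∀ z ∈ O, ‖cv z j Y ψ‖ ≤ E₀ * Real.exp (-((li F θ).κ * torusTreeLen Y.1))) →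
          ∀ (X : (domSys (F.P k) θ.τ9.M (k' + 1)).Dom) (φ : CPair (F.P k) (MatA N)),
            φ ∈ spaceI Sg Rz θ.τ9.M (k' + 1) (domSites (F.P k) θ.τ9.M (k' + 1) X) cs.α₀ cs.α₁ →
            ∀ (Z : (domSys (F.P k) θ.τ9.M (k' + 1)).Dom), Z.1 ⊆ X.1 → ∀ t ∈ terms (L F θ k) θ.τ9.M Z,
              DifferentiableOn ℂ (fun z => V k' Z t (cv z) φ) O ∧
                ∀ z ∈ O, ‖V k' Z t (cv z) φ‖ ≤ weight (L F θ k) θ.τ9.M (c F θ k) Z a t * Real.exp (a₅ * ((Z.1).card : ℝ))) ∧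
        (∀ k' : ℕ, k' < k → ∀ old : OlderTerms (F.P k) (MatA N) θ.τ9.M k',
          (∀ (j : Fin (k' + 1)) (Y : (domSys (F.P k) θ.τ9.M j).Dom) (ψ : CPair (F.P k) (MatA N)),
              ψ ∈ spaceI Sg Rz θ.τ9.M j (domSites (F.P k) θ.τ9.M j Y) cs.α₀ cs.α₁ → ‖old j Y ψ‖ ≤ E₀ * Real.exp (-((li F θ).κ * torusTreeLen Y.1))) →
          ∀ (X : (domSys (F.P k) θ.τ9.M (k' + 1)).Dom) (φ : CPair (F.P k) (MatA N)),
            φ ∈ spaceI Sg Rz θ.τ9.M (k' + 1) (domSites (F.P k) θ.τ9.M (k' + 1) X) cs.α₀ cs.α₁ →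
            ∀ (Z : (domSys (F.P k) θ.τ9.M (k' + 1)).Dom), Z.1 ⊆ X.1 → ∀ t ∈ terms (L F θ k) θ.τ9.M Z, ∀ z ∈ D k',
              ‖TFc k' Z t z old φ - V k' Z t old φ‖ ≤
                Mv * ‖z‖ ^ 2 * (weight (L F θ k) θ.τ9.M (c F θ k) Z a t * Real.exp (a₅ * ((Z.1).card : ℝ))))) :
    S_N22 (RRec₁₃Co (readingOfRecord₁₃Co (fun F θ => ReadingData.ofRecordAdm F θ.τ9.M N (runTowers fun k => toClusterTower ((𝔇 F θ k).Gn₀)) (sp F θ)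
        (gauge F θ) (hg F θ) (T₀ F θ) (hT F θ) (li F θ)) ℓ₃ ne2 ne1)) := by
  refine (s_N22_readingOfRecord₁₃Co_iff _ ℓ₃ ne2 ne1).mpr fun F D h k => ?_
  have h18' : S_N18 (RRec₁₃CoOn (readingOfRecord₁₃Co (fun F θ => ReadingData.ofRecordAdm F θ.τ9.M N (runTowers fun k => toClusterTower ((𝔇 F θ k).Gn₀)) (sp F θ)
        (gauge F θ) (hg F θ) (T₀ F θ) (hT F θ) (li F θ)) ℓ₃ ne2 ne1)
      fun F θ => ∃ (D : Datum F N) (h : Node00.IsDatumOfRecord₁₃CCo F N D), h.params = θ) := by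
    refine (s_N18_readingOfRecord₁₃CoOn_iff _ ℓ₃ ne2 ne1 _).mpr fun F θ _ hRg _ k' => ?_
    obtain ⟨D', h', rfl⟩ := hRg
    exact (s_N18_readingOfRecord₁₃Co_iff _ ℓ₃ ne2 ne1).mp h18 F D' h' k'
  exact (s_N22_readingOfRecord₁₃CoOn_iff _ ℓ₃ ne2 ne1 _).mp
    (s_N22_readingOfRecord₁₃CoOn_ofRecordAdm_runTowers_of_s_N18_relCentredTermDatum₀ c L 𝔇 sp gauge hg T₀ hT li ℓ₃ ne2 ne1
      (fun F θ => ∃ (D : Datum F N) (h : Node00.IsDatumOfRecord₁₃CCo F N D), h.params = θ) (G := G) h18' (fun F θ hP _ hθ => hnum F θ hP hθ)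
      (fun F θ hP _ hθ => hdata F θ hP hθ))
    F h.params h.provisos ⟨D, h, rfl⟩ h.admissible k

end Edge

end YMDAG.N22.W1

end
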